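import Summits.CriticalPhenomena.Ising3DConformalLimit.Theorems.EnergyNotSigmaSquaredGapForcesFarMergingPromotion
import Summits.CriticalPhenomena.Ising3DConformalLimit.Theorems.EnergyNotSigmaSquaredGapForcesFarMergingReduction

/-!
# `GapForcesFarMerging` (stmt-CriticalPhenomena-4468): the glued split into three explicit children

Route decl `Summit.CriticalPhenomena.Ising3DConformalLimit.Theses.EnergyNotSigmaSquared.GapForcesFarMerging`
(`= EnergyGapPowerLaw → FarMergingShape cc2 (criticalCorr 3 4)`, `Negative.SoftShapes.crux_iff`).

Purpose (lead seat c6). Eight lead seats ran the six planned lines of this crux; every line is dead as a LINE and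
every one of them is closed modulo ONE open analytic statement — one-passage quasi-multiplicativity of the
single-pinch avoidance functional of two SOURCED critical double currents on `ℤ³` (see
`EnergyNotSigmaSquaredGapForcesFarMergingPromotion`, `Cruxes/GapForcesFarMerging/{ITEM-TEXTS.md, CRUX-NOTES-c4.md,
STRATEGY-CENSUS.md, SPLIT-PACKAGE.md}`). The crux-strategist prepared the route-level split
`GapForcesFarMerging ⇐ IsoscelesReflectionMinors ∧ SinglePinchPositivity ∧ PinchQuasiMultiplicativityDyadic`
with children typed in item-ready EXPLICIT form (only `Literature.Probability.LatticeModels.criticalCorr`, no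
Theorems-level abbreviation). This file is the prover-landed glue of that split, over exactly those explicit texts:

* `GapForcesFarMerging_of_subs` — the registered stub of 4468 (children in the order QM-dyadic, isosceles RP minors,
  strict single-pinch positivity) concludes the crux BY NAME; proof = the accepted certificate
  `Negative.gapForcesFarMerging_of_three_stubs` (the explicit texts are definitionally
  `QuasiMultiplicativeDyadicShape / RPUnpinchIsoShape / SinglePinchPositiveShape` at `(cc2, criticalCorr 3 4)`);
* `isoscelesReflectionMinors_explicit`, `singlePinchPositivity_explicit` — the two flanking children are THEOREMS
  (landed `rpUnpinchIsoShape_criticalCorr` p76719 ← `stub_rpUnpinch` p74044, FILS78 Thm 2.1 site-reflection positivity;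
  `singlePinchPositiveShape_criticalCorr` ← `stub_singlePinchPositive` p74075), restated in the children's explicit text
  so that the filed support items close by one-line proofs importing this module;
* hence the only open child is `PinchQuasiMultiplicativityDyadic`; "QM-dyadic (explicit) → crux" alone is the landed
  `Promotion.gapForcesFarMerging_of_qmDyadicExplicit` (not restated here).

Notation in comments: `e₂ = Pi.single 1 1`, `up m = (2m,m,0)`, `dn m = (2m,-m,0)`,
`T(a,b;x,y) = ⟨σ_aσ_bσ_xσ_y⟩_{β_c} − ⟨σ_aσ_b⟩⟨σ_xσ_y⟩`, `𝒜(b;m) = T(0,b; up m, dn m)/(⟨σ₀σ_{dn m}⟩⟨σ_bσ_{up m}⟩)`.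

References: Fröhlich–Israel–Lieb–Simon, Comm. Math. Phys. 62 (1978), Thm. 2.1 [FILS1978]; Aizenman, Comm. Math.
Phys. 86 (1982) [AizenmanCMP1982]; Lawler, Intersections of Random Walks (1991), ch. 3–5 (quasi-multiplicativity of
non-intersection probabilities — the model for the open child) [Lawler1991].
-/

noncomputable section

namespace Summit.CriticalPhenomena.Ising3DConformalLimit.EnergyNotSigmaSquaredGapForcesFarMerging.Split

open Literature.Probability.LatticeModels
open Summit.CriticalPhenomena.Ising3DConformalLimit.Theses.EnergyNotSigmaSquared
open Summit.CriticalPhenomena.Ising3DConformalLimit.Theorems.GapForcesFarMerging.Negative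
  (cc2 RPUnpinchIsoShape SinglePinchPositiveShape QuasiMultiplicativeDyadicShape gapForcesFarMerging_of_three_stubs)
open Summit.CriticalPhenomena.Ising3DConformalLimit.EnergyNotSigmaSquaredGapForcesFarMerging
  (rpUnpinchIsoShape_criticalCorr singlePinchPositiveShape_criticalCorr)
open Summit.CriticalPhenomena.Ising3DConformalLimit.EnergyNotSigmaSquaredGapForcesFarMerging.Promotion
  (qmDyadicExplicit_iff)

/-- Child 1 `IsoscelesReflectionMinors` in explicit form IS `RPUnpinchIsoShape cc2 (criticalCorr 3 4)`
(definitional unfolding of `pairCovS, up, dn, xR, e₂, cc2`). [folklore] -/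
theorem isoExplicit_iff :
    (∀ m : ℕ, 1 ≤ m → (criticalCorr 3 4 ![0, Pi.single 1 1, Pi.single 0 (2 * (m : ℤ)) + Pi.single 1 (m : ℤ), Pi.single 0 (2 * (m : ℤ)) - Pi.single 1 (m : ℤ)] - criticalCorr 3 2 ![0, Pi.single 1 1] * criticalCorr 3 2 ![Pi.single 0 (2 * (m : ℤ)) + Pi.single 1 (m : ℤ), Pi.single 0 (2 * (m : ℤ)) - Pi.single 1 (m : ℤ)]) ^ 2 ≤ (criticalCorr 3 4 ![0, Pi.single 1 1, Pi.single 0 (2 * (m : ℤ)), Pi.single 0 (2 * (m : ℤ)) + Pi.single 1 1] - criticalCorr 3 2 ![0, Pi.single 1 1] * criticalCorr 3 2 ![Pi.single 0 (2 * (m : ℤ)), Pi.single 0 (2 * (m : ℤ)) + Pi.single 1 1]) * (criticalCorr 3 4 ![Pi.single 1 (m : ℤ), Pi.single 1 (-(m : ℤ)), Pi.single 0 (2 * (m : ℤ)) + Pi.single 1 (m : ℤ), Pi.single 0 (2 * (m : ℤ)) - Pi.single 1 (m : ℤ)] - criticalCorr 3 2 ![Pi.single 1 (m : ℤ), Pi.single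 1 (-(m : ℤ))] * criticalCorr 3 2 ![Pi.single 0 (2 * (m : ℤ)) + Pi.single 1 (m : ℤ), Pi.single 0 (2 * (m : ℤ)) - Pi.single 1 (m : ℤ)])) ↔
      RPUnpinchIsoShape cc2 (criticalCorr 3 4) :=
  Iff.rfl

/-- Child 2 `SinglePinchPositivity` in explicit form IS `SinglePinchPositiveShape cc2 (criticalCorr 3 4)`. [folklore] -/
theorem sppExplicit_iff :
    (∀ m : ℕ, 1 ≤ m → 0 < criticalCorr 3 4 ![0, Pi.single 1 1, Pi.single 0 (2 * (m : ℤ)) + Pi.single 1 (m : ℤ), Pi.single 0 (2 * (m : ℤ)) - Pi.single 1 (m : ℤ)] - criticalCorr 3 2 ![0, Pi.single 1 1] * criticalCorr 3 2 ![Pi.single 0 (2 * (m : ℤ)) + Pi.single 1 (m : ℤ), Pi.single 0 (2 * (m : ℤ)) - Pi.single 1 (m : ℤ)]) ↔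
      SinglePinchPositiveShape cc2 (criticalCorr 3 4) :=
  Iff.rfl

/-- **Child 1 is a theorem**: for every `m ≥ 1` the isosceles Gram minor of site-reflection positivity through the
plane `x₀ = m`, `T(0,e₂; up m, dn m)² ≤ T(0,e₂; 2m e₁, 2m e₁+e₂) · T(m e₂, −m e₂; up m, dn m)` — the explicit text of the
support child `IsoscelesReflectionMinors`, discharged by the landed `rpUnpinchIsoShape_criticalCorr`
(← `stub_rpUnpinch`). [cite: FILS1978, Thm. 2.1] -/
theorem isoscelesReflectionMinors_explicit :
    ∀ m : ℕ, 1 ≤ m → (criticalCorr 3 4 ![0, Pi.single 1 1, Pi.single 0 (2 * (m : ℤ)) + Pi.single 1 (m : ℤ), Pi.single 0 (2 * (m : ℤ)) - Pi.single 1 (m : ℤ)] - criticalCorr 3 2 ![0, Pi.single 1 1] * criticalCorr 3 2 ![Pi.single 0 (2 * (m : ℤ)) + Pi.single 1 (m : ℤ), Pi.single 0 (2 * (m : ℤ)) - Pi.single 1 (m : ℤ)]) ^ 2 ≤ (criticalCorr 3 4 ![0, Pi.single 1 1, Pi.single 0 (2 * (m : ℤ)), Pi.single 0 (2 * (m : ℤ))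 + Pi.single 1 1] - criticalCorr 3 2 ![0, Pi.single 1 1] * criticalCorr 3 2 ![Pi.single 0 (2 * (m : ℤ)), Pi.single 0 (2 * (m : ℤ)) + Pi.single 1 1]) * (criticalCorr 3 4 ![Pi.single 1 (m : ℤ), Pi.single 1 (-(m : ℤ)), Pi.single 0 (2 * (m : ℤ)) + Pi.single 1 (m : ℤ), Pi.single 0 (2 * (m : ℤ)) - Pi.single 1 (m : ℤ)] - criticalCorr 3 2 ![Pi.single 1 (m : ℤ), Pi.single 1 (-(m : ℤ))] * criticalCorr 3 2 ![Pi.single 0 (2 * (m : ℤ)) + Pi.single 1 (m : ℤ), Pi.single 0 (2 * (m : ℤ)) - Pi.single 1 (m : ℤ)]) :=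
  isoExplicit_iff.mpr rpUnpinchIsoShape_criticalCorr

/-- **Child 2 is a theorem**: strict positivity of the single-pinch truncation `T(0,e₂; up m, dn m) > 0` for all
`m ≥ 1` — the explicit text of the support child `SinglePinchPositivity`, discharged by the landed
`singlePinchPositiveShape_criticalCorr` (← `stub_singlePinchPositive`). [cite: AizenmanCMP1982, Prop. 5.3] -/
theorem singlePinchPositivity_explicit :
    ∀ m : ℕ, 1 ≤ m → 0 < criticalCorr 3 4 ![0, Pi.single 1 1, Pi.single 0 (2 * (m : ℤ)) + Pi.single 1 (m : ℤ), Pi.single 0 (2 * (m : ℤ)) - Pi.single 1 (m : ℤ)] - criticalCorr 3 2 ![0, Pi.single 1 1] * criticalCorr 3 2 ![Pi.single 0 (2 * (m : ℤ)) + Pi.single 1 (m : ℤ), Pi.single 0 (2 * (m : ℤ)) - Pi.single 1 (m : ℤ)] :=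
  sppExplicit_iff.mpr singlePinchPositiveShape_criticalCorr

/-- **The glue of the split (registered stub `GapForcesFarMerging_of_subs`)**: the three children in explicit form —
QM-dyadic (`PinchQuasiMultiplicativityDyadic`), the isosceles reflection minors, strict single-pinch positivity — imply
the crux BY NAME, through the accepted certificate `gapForcesFarMerging_of_three_stubs` (GAP is consumed there exactly
once, in `singlePinchLaw_of_gap_and_isoRP`, together with `0 < κ`; the iteration `scaleIteration_dyadic_criticalCorr`
is soft). [folklore] -/
theorem GapForcesFarMerging_of_subs :
    (∀ η : ℝ, 0 < η → η < 1 → ∃ ℓ₀ : ℕ, ∀ ℓ : ℕ, ℓ₀ ≤ ℓ → ∃ c : ℝ, η ^ ℓ ≤ c ∧ ∃ i₁ : ℕ, ∀ i : ℕ, i₁ ≤ i → c * ((criticalCorr 3 4 ![0, Pi.single 1 1, Pi.single 0 (2 * ((2 ^ i : ℕ) : ℤ)) + Pi.single 1 ((2 ^ i : ℕ) : ℤ), Pi.single 0 (2 * ((2 ^ i : ℕ) : ℤ)) - Pi.single 1 ((2 ^ i : ℕ) : ℤ)] - criticalCorr 3 2 ![0, Pi.single 1 1] * criticalCorr 3 2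 ![Pi.single 0 (2 * ((2 ^ i : ℕ) : ℤ)) + Pi.single 1 ((2 ^ i : ℕ) : ℤ), Pi.single 0 (2 * ((2 ^ i : ℕ) : ℤ)) - Pi.single 1 ((2 ^ i : ℕ) : ℤ)]) / (criticalCorr 3 2 ![0, Pi.single 0 (2 * ((2 ^ i : ℕ) : ℤ)) - Pi.single 1 ((2 ^ i : ℕ) : ℤ)] * criticalCorr 3 2 ![Pi.single 1 1, Pi.single 0 (2 * ((2 ^ i : ℕ) : ℤ)) + Pi.single 1 ((2 ^ i : ℕ) : ℤ)])) * ((criticalCorr 3 4 ![0, Pi.single 1 ((2 ^ i : ℕ) : ℤ), Pi.single 0 (2 * ((2 ^ (i + ℓ) : ℕ) : ℤ)) + Pi.single 1 ((2 ^ (i + ℓ) : ℕ) : ℤ), Pi.single 0 (2 * ((2 ^ (i + ℓ) : ℕ) : ℤ)) - Pi.single 1 ((2 ^ (i + ℓ) : ℕ) : ℤ)] - criticalCorr 3 2 ![0, Pi.single 1 ((2 ^ i : ℕ) : ℤ)] * criticalCorr 3 2 ![Pi.single 0 (2 * ((2 ^ (i + ℓ) : ℕ) : ℤ)) + Pi.single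 1 ((2 ^ (i + ℓ) : ℕ) : ℤ), Pi.single 0 (2 * ((2 ^ (i + ℓ) : ℕ) : ℤ)) - Pi.single 1 ((2 ^ (i + ℓ) : ℕ) : ℤ)]) / (criticalCorr 3 2 ![0, Pi.single 0 (2 * ((2 ^ (i + ℓ) : ℕ) : ℤ)) - Pi.single 1 ((2 ^ (i + ℓ) : ℕ) : ℤ)] * criticalCorr 3 2 ![Pi.single 1 ((2 ^ i : ℕ) : ℤ), Pi.single 0 (2 * ((2 ^ (i + ℓ) : ℕ) : ℤ)) + Pi.single 1 ((2 ^ (i + ℓ) : ℕ) : ℤ)])) ≤ ((criticalCorr 3 4 ![0, Pi.single 1 1, Pi.single 0 (2 * ((2 ^ (i + ℓ) : ℕ) : ℤ)) + Pi.single 1 ((2 ^ (i + ℓ) : ℕ) : ℤ), Pi.single 0 (2 * ((2 ^ (i + ℓ) : ℕ) : ℤ)) - Pi.single 1 ((2 ^ (i + ℓ) : ℕ) : ℤ)] - criticalCorr 3 2 ![0, Pi.single 1 1] * criticalCorr 3 2 ![Pi.single 0 (2 * ((2 ^ (i + ℓ) : ℕ) : ℤ)) + Pi.single 1 ((2 ^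 (i + ℓ) : ℕ) : ℤ), Pi.single 0 (2 * ((2 ^ (i + ℓ) : ℕ) : ℤ)) - Pi.single 1 ((2 ^ (i + ℓ) : ℕ) : ℤ)]) / (criticalCorr 3 2 ![0, Pi.single 0 (2 * ((2 ^ (i + ℓ) : ℕ) : ℤ)) - Pi.single 1 ((2 ^ (i + ℓ) : ℕ) : ℤ)] * criticalCorr 3 2 ![Pi.single 1 1, Pi.single 0 (2 * ((2 ^ (i + ℓ) : ℕ) : ℤ)) + Pi.single 1 ((2 ^ (i + ℓ) : ℕ) : ℤ)]))) →
    (∀ m : ℕ, 1 ≤ m → (criticalCorr 3 4 ![0, Pi.single 1 1, Pi.single 0 (2 * (m : ℤ)) + Pi.single 1 (m : ℤ), Pi.single 0 (2 * (m : ℤ)) - Pi.single 1 (m : ℤ)] - criticalCorr 3 2 ![0, Pi.single 1 1] * criticalCorr 3 2 ![Pi.single 0 (2 * (m : ℤ)) + Pi.single 1 (m : ℤ), Pi.single 0 (2 * (m : ℤ)) - Pi.single 1 (m : ℤ)]) ^ 2 ≤ (criticalCorr 3 4 ![0, Pi.single 1 1, Pi.single 0 (2 * (m : ℤ)), Pi.single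 0 (2 * (m : ℤ)) + Pi.single 1 1] - criticalCorr 3 2 ![0, Pi.single 1 1] * criticalCorr 3 2 ![Pi.single 0 (2 * (m : ℤ)), Pi.single 0 (2 * (m : ℤ)) + Pi.single 1 1]) * (criticalCorr 3 4 ![Pi.single 1 (m : ℤ), Pi.single 1 (-(m : ℤ)), Pi.single 0 (2 * (m : ℤ)) + Pi.single 1 (m : ℤ), Pi.single 0 (2 * (m : ℤ)) - Pi.single 1 (m : ℤ)] - criticalCorr 3 2 ![Pi.single 1 (m : ℤ), Pi.single 1 (-(m : ℤ))] * criticalCorr 3 2 ![Pi.single 0 (2 * (m : ℤ)) + Pi.single 1 (m : ℤ), Pi.single 0 (2 * (m : ℤ)) - Pi.single 1 (m : ℤ)])) →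
    (∀ m : ℕ, 1 ≤ m → 0 < criticalCorr 3 4 ![0, Pi.single 1 1, Pi.single 0 (2 * (m : ℤ)) + Pi.single 1 (m : ℤ), Pi.single 0 (2 * (m : ℤ)) - Pi.single 1 (m : ℤ)] - criticalCorr 3 2 ![0, Pi.single 1 1] * criticalCorr 3 2 ![Pi.single 0 (2 * (m : ℤ)) + Pi.single 1 (m : ℤ), Pi.single 0 (2 * (m : ℤ)) - Pi.single 1 (m : ℤ)]) →
      GapForcesFarMerging :=
  fun hQ hI hS => gapForcesFarMerging_of_three_stubs (isoExplicit_iff.mp hI) (sppExplicit_iff.mp hS)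
    (qmDyadicExplicit_iff.mp hQ)

end Summit.CriticalPhenomena.Ising3DConformalLimit.EnergyNotSigmaSquaredGapForcesFarMerging.Split

end
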